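import Summits.BirchSwinnertonDyer.BirchSwinnertonDyer.Theorems.EisensteinPrimesBSDpOnCellCStubC3HalvesBySign
import Summits.BirchSwinnertonDyer.BirchSwinnertonDyer.Theorems.EisensteinPrimesBSDpOnCellCResidualPub
import HarnessLib

/-!
# Crux 4 `BSDpOnCellC` (stmt-BirchSwinnertonDyer-19034), line b1: THE PUBLISHED-TIER RESIDUAL AFTER p626493 —
# the crux BY NAME with the `μ`-input SPLIT BY SIGN: NON-SPLIT = CGLS22 Prop. 14 [PUB], SPLIT = Keller–Yin
# Lemma 5.1.1 restricted to split `p` [PRE] (cell `bsd-eis`, seat `bsd-line-x2-p2` gen 4, D-0154 KEY row 5;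
# v13-shape residual; companions p626493, p623440, p613384)

HONEST FRAMING (cell `bsd-eis`, run/shared/lean/pub/bsd-eis/): composition only (no definition, no new named fact,
no `sorry`); a CONDITIONAL-RESULT on 17 published facts + CGLS22 Prop. 14 (published) + the route decls
`X2.Nonsplit/SplitKolyvaginDivOnTreeIntOther` (R-β, unprinted) + the split-restricted preprint claim of Keller–Yin
Lemma 5.1.1 (inline) + the frame `μ = 0` and the imprimitive count at every datum (inline, unprinted / preprint-gapped)
+ crux 3 by name; nothing about any curve is asserted; nothing booked; no label or count moves; BSD and the main
conjectures are proved for NO curve. Helper `--supports stmt-BirchSwinnertonDyer-19034`; closes no registered stub;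
the skeleton of record (b1 v12, 155e218d…) is NOT changed by this file (a v13 re-cut `stub_lemma511 ↦ stub_prop14
[PUB, fact-grade] + stub_lemma511Split [PRE]` would compose through it; W-79: registration is a LEAD's call).

## What

`bsdpOnCellC_of_publishedFacts_of_divIntOther_of_prop14_of_lemma511Split_of_muFrame_of_imprimitiveCount_of_cellB`:
`Summit.BirchSwinnertonDyer.BirchSwinnertonDyer.Theses.EisensteinPrimes.BSDpOnCellC` from
* `hPub` — v12 `stub_publishedFacts` VERBATIM (17 PUB facts);
* `hdivN`, `hdivS` — v12 `stub_divRbeta` (road R-β at 𝔭̄, unprinted);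
* `hprop14` — `CastellaGrossiLeeSkinner2022.prop14_residualCharacterSelmer_finite` (PUB; replaces the NON-SPLIT half
  of v12's `stub_lemma511` via p626493);
* `h511S` — Keller–Yin Lemma 5.1.1's typed statement with the extra binder `W.HasSplitMultiplicativeReductionAtPrime p`
  (the SPLIT half of v12's `stub_lemma511`; PRE);
* `hmuFN`, `hmuFS` — v12 `stub_muFrame`; `hcountN`, `hcountS` — v12 `stub_imprimitiveCount`;
* `hMCB` — crux 3 `MazurMCOnCellB` verbatim.
Proof: `StubC3HalvesBySign.invN_…` / `invS_…` then p613384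
(`BSDpOnCellCResidualPub.bsdpOnCellC_of_publishedFacts_of_divIntOther_of_oneInequality_of_cellB`).

References: [CastellaGrossiLeeSkinner2022] §1.2 Prop. 14; [KellerYin2024] Lemma 5.1.1, Lemma 5.1.2, Thm. 5.1.3;
[Castella2018Exceptional] Thms. 2.10–2.11; [Hsieh2014] Thm. 1; [LiuZhangZhang2018] Thms. 1.5.1, 1.5.3;
[Miller2011LMS] Def. 1.1; cell p626493, p623440, p613384.
-/

set_option autoImplicit false
set_option linter.dupNamespace false -- the summit namespace `…BirchSwinnertonDyer.BirchSwinnertonDyer.Theorems` (Sub = Summit, D-0017) trips it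

noncomputable section

open scoped Classical MatrixGroups ModularForm

open CongruenceSubgroup WeierstrassCurve NumberField IsDedekindDomain Field PowerSeries
  Literature.NumberTheory.EllipticCurves Literature.NumberTheory.EllipticCurves.GreenbergSelmer
  Literature.NumberTheory.EllipticCurves.GreenbergVatsal2000
  Literature.NumberTheory.EllipticCurves.ModularForms Literature.NumberTheory.QuadraticFields
  Literature.NumberTheory.EllipticCurves.Rank1Residual
  Literature.NumberTheory.EllipticCurves.Rank1Residual.Typed
  Literature.NumberTheory.EllipticCurves.KrizLi2019
  Literature.NumberTheory.EllipticCurves.Wuthrich2014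
  Literature.NumberTheory.EllipticCurves.SteinWuthrich2013
  Literature.NumberTheory.EllipticCurves.Castella2018Exceptional
  Literature.NumberTheory.GaloisRepresentations Literature.NumberTheory.GaloisCohomology
  Literature.NumberTheory.Automorphic
  Summit.BirchSwinnertonDyer.Rank1Residual.X11b.AcSelmer
  Summit.BirchSwinnertonDyer.Rank1Residual.X11b.Halves
  Summit.BirchSwinnertonDyer.Rank1Residual.X11b
  Summit.BirchSwinnertonDyer.Rank1Residual Summit.BirchSwinnertonDyer.Rank1Residual.X1
  Summit.BirchSwinnertonDyer.Rank1Residual.X2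
  Summit.BirchSwinnertonDyer.BirchSwinnertonDyer.Theorems
open Literature.NumberTheory.EllipticCurves.KellerYin2024
  (curveLocalLambda lemma511_imprimitive_isTorsion_muInvariant_eq_zero_mult_OPEN)
open Literature.NumberTheory.EllipticCurves.CastellaGrossiLeeSkinner2022 (prop14_residualCharacterSelmer_finite)

namespace Summit.BirchSwinnertonDyer.BirchSwinnertonDyer.Theorems.BSDpOnCellCResidualV13

/-- **Crux 4 `BSDpOnCellC` BY NAME from [17 PUB facts] + [road R-β] + [CGLS22 Prop. 14, PUB, for the non-split
sign] + [Keller–Yin Lemma 5.1.1 restricted to split `p`, PRE] + [`μ(𝓛^BDP_𝔭) = 0` and the IMPRIMITIVE count at every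
datum] + [crux 3].** Composition = p613384 with `hinvN` from `StubC3HalvesBySign.invN_of_prop14_of_muFrame_of_imprimitiveCount`
(through p626493) and `hinvS` from `StubC3HalvesBySign.invS_of_lemma511Split_of_muFrame_of_imprimitiveCount`.
CONDITIONAL-RESULT: the honest published-tier price of the crux on line b1 after p626493; BSD is proved for no curve.
[claim: KellerYin2024, status: under-review]
[cite: CastellaGrossiLeeSkinner2022, §1.2 Prop. 14 (arXiv:2008.02571; Invent. Math. 227 (2022))]
[cite: KellerYin2024, Lemma 5.1.1 (L1744–1749), Lemma 5.1.2 (L1750–1769), §3 and Thm. 5.1.3 = Thm. D (arXiv:2402.12781v2) (shape only)]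
[cite: Castella2018Exceptional, Thm. 2.10 and Thm. 2.11] [cite: LiuZhangZhang2018, Thm. 1.5.1 and Thm. 1.5.3]
[cite: Hsieh2014, Thm. 1] [cite: Miller2011LMS, Def. 1.1] -/
theorem bsdpOnCellC_of_publishedFacts_of_divIntOther_of_prop14_of_lemma511Split_of_muFrame_of_imprimitiveCount_of_cellB
    (hPub : ((lambdaMu_multiplicative_of_gvPar ∧ thm16_charIdeal_dvd_multiplicative_of_reducible ∧
      thm61_splitMultiplicative ∧ thm61_nonsplitMultiplicative ∧
      (∀ (W : WeierstrassCurve ℚ) [W.IsElliptic] [W.IsGloballyMinimal] (p : ℕ) [Fact p.Prime],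
        greenberg_stevens (W := W) (p := p)) ∧
      exists_isNewformOf ∧
      (∀ (K : Type) [Field K] [NumberField K], poitouTate_selmerStructure_duality K) ∧
      (∀ (K : Type) [Field K] [NumberField K], poitouTate_sha_tateDual K) ∧
      hsieh2014_exists_anticyclotomicPAdicLFunction ∧
      (∀ (N : ℕ) [NeZero N] (W : WeierstrassCurve ℚ) (K : Type) [Field K] [NumberField K],
        gross_zagier N W K) ∧
      (∀ (N : ℕ) [NeZero N] (W : WeierstrassCurve ℚ) (K : Type) [Field K] [NumberField K],
        kolyvagin N W K) ∧
      rank_eq_analyticRank_of_analyticRank_le_one ∧ HoffsteinLuo1997_exists_twist_L_one_ne_zero ∧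
      mazur_not_dvd_maninConstant_of_odd ∧ bsdRHS_eq_of_isIsogenous) ∧
      thm210_thm211_bdpDisplay_pNew) ∧
      LiuZhangZhang2018.thm151_thm153_modularCurve_heegnerVector)
    (hdivN : ∀ (W : WeierstrassCurve ℚ) [W.IsElliptic] [W.IsGloballyMinimal] (p : ℕ) [Fact p.Prime],
      CellC W p → ¬ W.HasSplitMultiplicativeReductionAtPrime p → NonsplitKolyvaginDivOnTreeIntOther W p)
    (hdivS : ∀ (W : WeierstrassCurve ℚ) [W.IsElliptic] [W.IsGloballyMinimal] (p : ℕ) [Fact p.Prime],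
      CellC W p → W.HasSplitMultiplicativeReductionAtPrime p → SplitKolyvaginDivOnTreeIntOther W p)
    (hprop14 : prop14_residualCharacterSelmer_finite)
    (h511S : ∀ {p : ℕ} [Fact p.Prime] (W : WeierstrassCurve ℚ) [W.IsElliptic] [W.IsGloballyMinimal]
        (K : Type) [Field K] [NumberField K] (vbar : HeightOneSpectrum (𝓞 K))
        (κ : ZpExtension K p) (γ : absoluteGaloisGroup K) [Fact (κ.IsTopGenerator γ)]
        (Sf : Finset (HeightOneSpectrum (𝓞 K))),
        2 < p → Mult W p → W.HasSplitMultiplicativeReductionAtPrime p → Red W p →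
        IsImaginaryQuadratic K → SatisfiesHeegnerHypothesis (W.conductorNorm ℤ) K →
          Odd (NumberField.discr K) → NumberField.discr K ≠ -3 →
          ((Ideal.span {(p : ℤ)}).primesOver (𝓞 K)).ncard = 2 →
        ((p : ℕ) : 𝓞 K) ∈ vbar.asIdeal → κ.IsAnticyclotomic →
        (∀ w : HeightOneSpectrum (𝓞 K), w ∈ Sf ↔
          (((W.conductorNorm ℤ : ℤ) : 𝓞 K) ∈ w.asIdeal ∧ ((p : ℕ) : 𝓞 K) ∉ w.asIdeal)) →
        Module.IsTorsion (IwasawaAlgebra p)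
            (Castella2018.AcSelmer.XAc (W.baseChange K) p κ vbar (↑Sf : Set (HeightOneSpectrum (𝓞 K))) γ) ∧
          muInvariant p
            (Castella2018.AcSelmer.XAc (W.baseChange K) p κ vbar (↑Sf : Set (HeightOneSpectrum (𝓞 K))) γ) = 0)
    (hmuFN :
      ∀ (W : WeierstrassCurve ℚ) [W.IsElliptic] [W.IsGloballyMinimal] (p : ℕ) [Fact p.Prime],
        ∀ (N : ℕ) [NeZero N] (K : Type) [Field K] [NumberField K] (Dt : ModularParametrizationData W N)
          (H : HeegnerDatum N (NumberField.discr K)) (ιK : K →+* ℂ) (P : (W.baseChange K).toAffine.Point),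
          CellC W p → ¬ W.HasSplitMultiplicativeReductionAtPrime p → W.conductorNorm ℤ = N →
          IsImaginaryQuadratic K → NumberField.discr K < -4 → SatisfiesHeegnerHypothesis N K →
          (W.quadraticTwist (NumberField.discr K : ℚ)).entireLFunction 1 ≠ 0 →
          WeierstrassCurve.Affine.Point.map ιK.toRatAlgHom P = heegnerPointComplex Dt H →
          ¬ (p : ℤ) ∣ Dt.c → ¬ IsOfFinAddOrder P →
          Odd (NumberField.discr K) →
          ∀ (κ : ZpExtension K p), κ.IsAnticyclotomic →
            ∀ (γ : Field.absoluteGaloisGroup K) [Fact (κ.IsTopGenerator γ)]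
              (𝔭 : HeightOneSpectrum (𝓞 K)), ((p : ℕ) : 𝓞 K) ∈ 𝔭.asIdeal →
              𝔭.asIdeal.ramificationIdx (𝓞 ℚ) = 1 → 𝔭.asIdeal.inertiaDeg (𝓞 ℚ) = 1 →
              ∀ (𝔭bar : HeightOneSpectrum (𝓞 K)), ((p : ℕ) : 𝓞 K) ∈ 𝔭bar.asIdeal → 𝔭bar ≠ 𝔭 →
                ((Ideal.span {(p : ℤ)}).primesOver (𝓞 K)).ncard = 2 →
              ∀ (f : CuspForm (CongruenceSubgroup.Gamma0 N) 2), IsNewformOf W f →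
                ∀ (ι' : PadicAlgCl p ≃+* ℂ),
                  (∀ (w : InfinitePlace K) (k : 𝓞 K),
                    k ∈ 𝔭.asIdeal ↔ ‖ι'.symm (w.embedding (k : K))‖ < 1) →
                  ∀ (ΩK : ℂ) (Ωp : ℂ_[p]) (Q : PowerSeries 𝓞_ℂ_[p]), ΩK ≠ 0 → ‖Ωp‖ = 1 →
                    R1.IsBDPLFunctionInt p ι' 𝔭 κ γ f ΩK Ωp Q →
                      ∃ m : ℕ, ‖((PowerSeries.coeff m Q : 𝓞_ℂ_[p]) : ℂ_[p])‖ = 1 ∧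
                  ∀ i < m, ‖((PowerSeries.coeff i Q : 𝓞_ℂ_[p]) : ℂ_[p])‖ < 1)
    (hmuFS :
      ∀ (W : WeierstrassCurve ℚ) [W.IsElliptic] [W.IsGloballyMinimal] (p : ℕ) [Fact p.Prime],
        ∀ (N : ℕ) [NeZero N] (K : Type) [Field K] [NumberField K] (Dt : ModularParametrizationData W N)
          (H : HeegnerDatum N (NumberField.discr K)) (ιK : K →+* ℂ) (P : (W.baseChange K).toAffine.Point),
          CellC W p → W.HasSplitMultiplicativeReductionAtPrime p → W.conductorNorm ℤ = N →
          IsImaginaryQuadratic K → NumberField.discr K < -4 → SatisfiesHeegnerHypothesis N K →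
          (W.quadraticTwist (NumberField.discr K : ℚ)).entireLFunction 1 ≠ 0 →
          WeierstrassCurve.Affine.Point.map ιK.toRatAlgHom P = heegnerPointComplex Dt H →
          ¬ (p : ℤ) ∣ Dt.c → ¬ IsOfFinAddOrder P →
          Odd (NumberField.discr K) →
          ∀ (κ : ZpExtension K p), κ.IsAnticyclotomic →
            ∀ (γ : Field.absoluteGaloisGroup K) [Fact (κ.IsTopGenerator γ)]
              (𝔭 : HeightOneSpectrum (𝓞 K)), ((p : ℕ) : 𝓞 K) ∈ 𝔭.asIdeal →
              𝔭.asIdeal.ramificationIdx (𝓞 ℚ) = 1 → 𝔭.asIdeal.inertiaDeg (𝓞 ℚ) = 1 →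
              ∀ (𝔭bar : HeightOneSpectrum (𝓞 K)), ((p : ℕ) : 𝓞 K) ∈ 𝔭bar.asIdeal → 𝔭bar ≠ 𝔭 →
                ((Ideal.span {(p : ℤ)}).primesOver (𝓞 K)).ncard = 2 →
              ∀ (f : CuspForm (CongruenceSubgroup.Gamma0 N) 2), IsNewformOf W f →
                ∀ (ι' : PadicAlgCl p ≃+* ℂ),
                  (∀ (w : InfinitePlace K) (k : 𝓞 K),
                    k ∈ 𝔭.asIdeal ↔ ‖ι'.symm (w.embedding (k : K))‖ < 1) →
                  ∀ (ΩK : ℂ) (Ωp : ℂ_[p]) (Q : PowerSeries 𝓞_ℂ_[p]), ΩK ≠ 0 → ‖Ωp‖ = 1 →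
                    R1.IsBDPLFunctionInt p ι' 𝔭 κ γ f ΩK Ωp Q →
                      ∃ m : ℕ, ‖((PowerSeries.coeff m Q : 𝓞_ℂ_[p]) : ℂ_[p])‖ = 1 ∧
                  ∀ i < m, ‖((PowerSeries.coeff i Q : 𝓞_ℂ_[p]) : ℂ_[p])‖ < 1)
    (hcountN :
      ∀ (W : WeierstrassCurve ℚ) [W.IsElliptic] [W.IsGloballyMinimal] (p : ℕ) [Fact p.Prime],
        ∀ (N : ℕ) [NeZero N] (K : Type) [Field K] [NumberField K] (Dt : ModularParametrizationData W N)
          (H : HeegnerDatum N (NumberField.discr K)) (ιK : K →+* ℂ) (P : (W.baseChange K).toAffine.Point),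
          CellC W p → ¬ W.HasSplitMultiplicativeReductionAtPrime p → W.conductorNorm ℤ = N →
          IsImaginaryQuadratic K → NumberField.discr K < -4 → SatisfiesHeegnerHypothesis N K →
          (W.quadraticTwist (NumberField.discr K : ℚ)).entireLFunction 1 ≠ 0 →
          WeierstrassCurve.Affine.Point.map ιK.toRatAlgHom P = heegnerPointComplex Dt H →
          ¬ (p : ℤ) ∣ Dt.c → ¬ IsOfFinAddOrder P →
          Odd (NumberField.discr K) →
          ∀ (κ : ZpExtension K p), κ.IsAnticyclotomic →
            ∀ (γ : Field.absoluteGaloisGroup K) [Fact (κ.IsTopGenerator γ)]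
              (𝔭 : HeightOneSpectrum (𝓞 K)), ((p : ℕ) : 𝓞 K) ∈ 𝔭.asIdeal →
              𝔭.asIdeal.ramificationIdx (𝓞 ℚ) = 1 → 𝔭.asIdeal.inertiaDeg (𝓞 ℚ) = 1 →
              ∀ (𝔭bar : HeightOneSpectrum (𝓞 K)), ((p : ℕ) : 𝓞 K) ∈ 𝔭bar.asIdeal → 𝔭bar ≠ 𝔭 →
                ((Ideal.span {(p : ℤ)}).primesOver (𝓞 K)).ncard = 2 →
              ∀ (f : CuspForm (CongruenceSubgroup.Gamma0 N) 2), IsNewformOf W f →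
                ∀ (ι' : PadicAlgCl p ≃+* ℂ),
                  (∀ (w : InfinitePlace K) (k : 𝓞 K),
                    k ∈ 𝔭.asIdeal ↔ ‖ι'.symm (w.embedding (k : K))‖ < 1) →
                  ∀ (ΩK : ℂ) (Ωp : ℂ_[p]) (Q : PowerSeries 𝓞_ℂ_[p]), ΩK ≠ 0 → ‖Ωp‖ = 1 →
                    R1.IsBDPLFunctionInt p ι' 𝔭 κ γ f ΩK Ωp Q →
                      ∀ (Sf : Finset (HeightOneSpectrum (𝓞 K))),
                        (∀ w : HeightOneSpectrum (𝓞 K), w ∈ Sf ↔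
                          (((W.conductorNorm ℤ : ℤ) : 𝓞 K) ∈ w.asIdeal ∧ ((p : ℕ) : 𝓞 K) ∉ w.asIdeal)) →
                        ∀ m : ℕ, ‖((PowerSeries.coeff m Q : 𝓞_ℂ_[p]) : ℂ_[p])‖ = 1 →
                          (∀ i < m, ‖((PowerSeries.coeff i Q : 𝓞_ℂ_[p]) : ℂ_[p])‖ < 1) →
                            m + ∑ w ∈ Sf, curveLocalLambda κ (W.baseChange K) w ≤
                              lambdaInvariant p (XAc (W.baseChange K) p κ 𝔭bar (↑Sf : Set (HeightOneSpectrum (𝓞 K))) γ))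
    (hcountS :
      ∀ (W : WeierstrassCurve ℚ) [W.IsElliptic] [W.IsGloballyMinimal] (p : ℕ) [Fact p.Prime],
        ∀ (N : ℕ) [NeZero N] (K : Type) [Field K] [NumberField K] (Dt : ModularParametrizationData W N)
          (H : HeegnerDatum N (NumberField.discr K)) (ιK : K →+* ℂ) (P : (W.baseChange K).toAffine.Point),
          CellC W p → W.HasSplitMultiplicativeReductionAtPrime p → W.conductorNorm ℤ = N →
          IsImaginaryQuadratic K → NumberField.discr K < -4 → SatisfiesHeegnerHypothesis N K →
          (W.quadraticTwist (NumberField.discr K : ℚ)).entireLFunction 1 ≠ 0 →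
          WeierstrassCurve.Affine.Point.map ιK.toRatAlgHom P = heegnerPointComplex Dt H →
          ¬ (p : ℤ) ∣ Dt.c → ¬ IsOfFinAddOrder P →
          Odd (NumberField.discr K) →
          ∀ (κ : ZpExtension K p), κ.IsAnticyclotomic →
            ∀ (γ : Field.absoluteGaloisGroup K) [Fact (κ.IsTopGenerator γ)]
              (𝔭 : HeightOneSpectrum (𝓞 K)), ((p : ℕ) : 𝓞 K) ∈ 𝔭.asIdeal →
              𝔭.asIdeal.ramificationIdx (𝓞 ℚ) = 1 → 𝔭.asIdeal.inertiaDeg (𝓞 ℚ) = 1 →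
              ∀ (𝔭bar : HeightOneSpectrum (𝓞 K)), ((p : ℕ) : 𝓞 K) ∈ 𝔭bar.asIdeal → 𝔭bar ≠ 𝔭 →
                ((Ideal.span {(p : ℤ)}).primesOver (𝓞 K)).ncard = 2 →
              ∀ (f : CuspForm (CongruenceSubgroup.Gamma0 N) 2), IsNewformOf W f →
                ∀ (ι' : PadicAlgCl p ≃+* ℂ),
                  (∀ (w : InfinitePlace K) (k : 𝓞 K),
                    k ∈ 𝔭.asIdeal ↔ ‖ι'.symm (w.embedding (k : K))‖ < 1) →
                  ∀ (ΩK : ℂ) (Ωp : ℂ_[p]) (Q : PowerSeries 𝓞_ℂ_[p]), ΩK ≠ 0 → ‖Ωp‖ = 1 →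
                    R1.IsBDPLFunctionInt p ι' 𝔭 κ γ f ΩK Ωp Q →
                      ∀ (Sf : Finset (HeightOneSpectrum (𝓞 K))),
                        (∀ w : HeightOneSpectrum (𝓞 K), w ∈ Sf ↔
                          (((W.conductorNorm ℤ : ℤ) : 𝓞 K) ∈ w.asIdeal ∧ ((p : ℕ) : 𝓞 K) ∉ w.asIdeal)) →
                        ∀ m : ℕ, ‖((PowerSeries.coeff m Q : 𝓞_ℂ_[p]) : ℂ_[p])‖ = 1 →
                          (∀ i < m, ‖((PowerSeries.coeff i Q : 𝓞_ℂ_[p]) : ℂ_[p])‖ < 1) →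
                            m + ∑ w ∈ Sf, curveLocalLambda κ (W.baseChange K) w ≤
                              lambdaInvariant p (XAc (W.baseChange K) p κ 𝔭bar (↑Sf : Set (HeightOneSpectrum (𝓞 K))) γ))
    (hMCB : Summit.BirchSwinnertonDyer.BirchSwinnertonDyer.Theses.EisensteinPrimes.MazurMCOnCellB) :
    Summit.BirchSwinnertonDyer.BirchSwinnertonDyer.Theses.EisensteinPrimes.BSDpOnCellC :=
  BSDpOnCellCResidualPub.bsdpOnCellC_of_publishedFacts_of_divIntOther_of_oneInequality_of_cellB hPub hdivN hdivS
    (StubC3HalvesBySign.invN_of_prop14_of_muFrame_of_imprimitiveCount hprop14 hmuFN hcountN)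
    (StubC3HalvesBySign.invS_of_lemma511Split_of_muFrame_of_imprimitiveCount h511S hmuFS hcountS) hMCB

end Summit.BirchSwinnertonDyer.BirchSwinnertonDyer.Theorems.BSDpOnCellCResidualV13

end
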